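import Literature.MathematicalPhysics.QuantumLattice.HubbardOpenBoxEDCertificateKroneckerSwap
import HarnessLib

/-!
# Data-free sector certificates: row blocks (one kernel declaration per block of residual rows)

Topic `MathematicalPhysics/QuantumLattice`, family `hubbard`. Companion of
`HubbardOpenBoxEDCertificateKronecker` / `…Swap`. `KCert.check` is ONE Boolean: for the largest spin
sectors of the open `2 × 3` cluster (`n = 400`) its kernel evaluation (`≈ 150 s`) sits at the ceiling a
single declaration can use on the check farm. Here the same check is offered in PIECES that the kernel
evaluates in separate declarations — `KCert.checkBase` (everything but the residual rows) and
`KCert.checkRows i₀ c` (the diagonal dominance of the residual rows `i₀, …, i₀ + c − 1`; each piece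
recomputes the untrusted factor) — together with the glue: `KCert.Passes` (base `∧` all rows),
`rowPass_of_checkRows`, `passes_of_check`, **`KCert.check_of_passes`** (the pieces imply the one
Boolean, so `KCert.sound` applies verbatim: `KCert.sound₂`), and the assembly
**`groundEnergy_ge_of_kCerts₃`** (sectors `p ≤ q`, hypotheses `Passes`).

Everything is proved; no named fact; nothing numerical is asserted here.

## References

* I. Kull, N. Schuch, B. Dive, M. Navascués, PRX 14 (2024) 021008, §5.3. [cite: KullEtAl2024, §5.3]
* S. M. Rump, BIT 46 (2006) 433, §2. [cite: Rump2006PosDef, §2]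
* A. Neumaier, Acta Numerica 13 (2004), §11 (certificates checked piecewise). [cite: Neumaier2004CompleteSearch, §11]
-/

namespace Literature.MathematicalPhysics.QuantumLattice

namespace OccupationCode

open Finset Matrix Literature.Computation.Certificates Literature.Computation.Certificates.PSD
  Literature.Computation.Certificates.PSD.Packed

/-- `f i₀ && f (i₀+1) && … && f (i₀+c−1)` (structural in `c`). [cite: Neumaier2004CompleteSearch, §11] -/
def allFrom (f : ℕ → Bool) : ℕ → ℕ → Bool
  | _, 0 => true
  | i, c + 1 => f i && allFrom f (i + 1) c

/-- Semantics of `allFrom`. [cite: Neumaier2004CompleteSearch, §11] -/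
theorem allFrom_spec (f : ℕ → Bool) : ∀ (i₀ c : ℕ), allFrom f i₀ c = true → ∀ i, i₀ ≤ i → i < i₀ + c → f i = true
  | _, 0, _, i, h1, h2 => by omega
  | i₀, c + 1, h, i, h1, h2 => by
      rw [allFrom, Bool.and_eq_true] at h
      rcases Nat.eq_or_lt_of_le h1 with rfl | hlt
      · exact h.1
      · exact allFrom_spec f (i₀ + 1) c h.2 i hlt (by omega)

/-- Joining two consecutive row ranges (piecewise certificate checking). [cite: Neumaier2004CompleteSearch, §11] -/
theorem rows_join {P : ℕ → Prop} {i₀ i₁ i₂ : ℕ} (h₁ : ∀ i, i₀ ≤ i → i < i₁ → P i) (h₂ : ∀ i, i₁ ≤ i → i < i₂ → P i) :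
    ∀ i, i₀ ≤ i → i < i₂ → P i := fun i ha hb =>
  (Nat.lt_or_ge i i₁).elim (fun h => h₁ i ha h) (fun h => h₂ i h hb)

/-- A row range from `0` covering `n` gives all rows below `n` (piecewise certificate checking). [cite: Neumaier2004CompleteSearch, §11] -/
theorem rows_all {P : ℕ → Prop} {n m : ℕ} (h : ∀ i, 0 ≤ i → i < m → P i) (hm : n ≤ m) : ∀ i < n, P i :=
  fun i hi => h i (Nat.zero_le i) (lt_of_lt_of_le hi hm)

namespace KCert

variable (C : KCert)

/-- The packed matrix rows of the sector code list `L` (as inside `check`). [cite: LinGubernatis1993, §II] -/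
def rowsOf (a b : ℕ) (TN TD UU : ℤ) (L : List ℕ) : List ℕ :=
  rowsAFast a b TN TD UU C.K C.c C.y (2 ^ (C.y - 1)) (geomNat (2 ^ C.y) L.length) (rankTab L 0) L 0

/-- **Base check**: everything in `check` except the residual rows (sector list, rank table, no-carry
bounds, factor length, peel of every factor row). [cite: Rump2006PosDef, §2] -/
def checkBase (a b p q : ℕ) (TN TD UU : ℤ) (Q : ℕ) (L : List ℕ) : Bool :=
  let n := L.length
  let X := 2 ^ C.x
  let OA := 2 ^ (C.y - 1)
  let RT := rankTab L 0
  let P := C.factorOf a b TN TD UU L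
  decide (0 < Q) && decide (0 < C.K) && decide (1 ≤ C.y) && sectorListOK a b p q L && rankOK RT L 0 &&
    decide (C.K * (hzBound (a * b) TN TD UU + C.c.natAbs) < OA) &&
    (P.length == n) && P.all (fun r => peelOK X (2 * C.O) (List.replicate n 1) r.p 0 0 r.r r.t) &&
    decide (n * (2 * C.O) ^ 2 < X)

/-- Residual row `i` passes (`rowOK` on the `i`-th packed matrix row and factor row). [cite: Rump2006PosDef, §2] -/
def rowPass (a b : ℕ) (TN TD UU : ℤ) (L : List ℕ) (i : ℕ) : Bool :=
  rowOK C.y C.x (C.x * (L.length - 1)) C.O (2 ^ (C.y - 1)) L.length ((C.rowsOf a b TN TD UU L).getD i 0)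
    ((C.factorOf a b TN TD UU L).getD i ⟨0, 0, 0⟩) i (C.factorOf a b TN TD UU L)

/-- **Row-block check**: rows `i₀, …, i₀ + c − 1` pass (ONE kernel declaration per block; the untrusted
factor is recomputed in each). [cite: Neumaier2004CompleteSearch, §11] -/
def checkRows (a b : ℕ) (TN TD UU : ℤ) (L : List ℕ) (i₀ c : ℕ) : Bool :=
  allFrom (C.rowPass a b TN TD UU L) i₀ c

/-- **A certificate passes in pieces**: base check and every residual row. [cite: Rump2006PosDef, §2] -/
def Passes (a b p q : ℕ) (TN TD UU : ℤ) (Q : ℕ) (L : List ℕ) : Prop :=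
  C.checkBase a b p q TN TD UU Q L = true ∧ ∀ i < L.length, C.rowPass a b TN TD UU L i = true

/-- Rows of a passing block pass. [cite: Neumaier2004CompleteSearch, §11] -/
theorem rowPass_of_checkRows {a b : ℕ} {TN TD UU : ℤ} {L : List ℕ} {i₀ c : ℕ}
    (h : C.checkRows a b TN TD UU L i₀ c = true) : ∀ i, i₀ ≤ i → i < i₀ + c → C.rowPass a b TN TD UU L i = true :=
  allFrom_spec _ i₀ c h

/-- Length of the fast packed-row list. [folklore] -/
private theorem length_rowsAFast (a b : ℕ) (TN TD UU : ℤ) (K : ℕ) (c : ℤ) (y O G RT : ℕ) :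
    ∀ (L : List ℕ) (i : ℕ), (rowsAFast a b TN TD UU K c y O G RT L i).length = L.length
  | [], _ => rfl
  | m :: rest, i => by simp [rowsAFast, length_rowsAFast a b TN TD UU K c y O G RT rest (i + 1)]

/-- `ddAllN` succeeds when every row passes (completeness of the walk). [folklore] -/
private theorem ddAllN_of_rows (y x sh O OA n : ℕ) (P : List Row) :
    ∀ (i₀ : ℕ) (RAs : List ℕ) (qs : List Row), RAs.length = qs.length →
      (∀ k < qs.length, rowOK y x sh O OA n (RAs.getD k 0) (qs.getD k ⟨0, 0, 0⟩) (i₀ + k) P = true) →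
      ddAllN y x sh O OA n P i₀ RAs qs = true
  | _, [], [], _, _ => rfl
  | _, [], _ :: _, hl, _ => by simp at hl
  | _, _ :: _, [], hl, _ => by simp at hl
  | i₀, RA :: RAs, qi :: qs, hl, h => by
      rw [ddAllN, Bool.and_eq_true]
      refine ⟨by simpa using h 0 (by simp), ddAllN_of_rows y x sh O OA n P (i₀ + 1) RAs qs (by simpa using hl) ?_⟩
      intro k hk
      have := h (k + 1) (by simpa using hk)
      simpa [add_assoc, add_comm 1 k] using this

/-- Entries of a `drop`-free walk: the `k`-th rows at offset `0`. [folklore] -/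
private theorem rowPass_eq {a b : ℕ} {TN TD UU : ℤ} {L : List ℕ} (i : ℕ) :
    C.rowPass a b TN TD UU L i = rowOK C.y C.x (C.x * (L.length - 1)) C.O (2 ^ (C.y - 1)) L.length
      ((C.rowsOf a b TN TD UU L).getD i 0) ((C.factorOf a b TN TD UU L).getD i ⟨0, 0, 0⟩) (0 + i)
      (C.factorOf a b TN TD UU L) := by
  rw [rowPass, zero_add]

/-- **The pieces imply the one Boolean**: `Passes → check = true`. [cite: Rump2006PosDef, §2] -/
theorem check_of_passes {a b p q : ℕ} {TN TD UU : ℤ} {Q : ℕ} {L : List ℕ}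
    (h : C.Passes a b p q TN TD UU Q L) : C.check a b p q TN TD UU Q L = true := by
  obtain ⟨hb, hr⟩ := h
  have hb' := hb
  simp only [checkBase, Bool.and_eq_true, decide_eq_true_eq, beq_iff_eq] at hb'
  obtain ⟨⟨⟨⟨⟨⟨⟨⟨_, _⟩, _⟩, _⟩, _⟩, _⟩, hlen⟩, _⟩, _⟩ := hb'
  have hlenRA : (C.rowsOf a b TN TD UU L).length = (C.factorOf a b TN TD UU L).length := by
    rw [rowsOf, length_rowsAFast, hlen]
  have hdd : ddAllN C.y C.x (C.x * (L.length - 1)) C.O (2 ^ (C.y - 1)) L.length (C.factorOf a b TN TD UU L) 0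
      (C.rowsOf a b TN TD UU L) (C.factorOf a b TN TD UU L) = true :=
    ddAllN_of_rows _ _ _ _ _ _ _ 0 _ _ hlenRA fun k hk => by
      rw [← rowPass_eq]; exact hr k (by rw [hlen] at hk; exact hk)
  have e : C.check a b p q TN TD UU Q L = (C.checkBase a b p q TN TD UU Q L &&
      ddAllN C.y C.x (C.x * (L.length - 1)) C.O (2 ^ (C.y - 1)) L.length (C.factorOf a b TN TD UU L) 0
        (C.rowsOf a b TN TD UU L) (C.factorOf a b TN TD UU L)) := rfl
  rw [e, hb, hdd, Bool.true_and]

/-- **The one Boolean implies the pieces** (so small sectors may keep using `check`). [cite: Rump2006PosDef, §2] -/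
theorem passes_of_check {a b p q : ℕ} {TN TD UU : ℤ} {Q : ℕ} {L : List ℕ}
    (h : C.check a b p q TN TD UU Q L = true) : C.Passes a b p q TN TD UU Q L := by
  have e : C.check a b p q TN TD UU Q L = (C.checkBase a b p q TN TD UU Q L &&
      ddAllN C.y C.x (C.x * (L.length - 1)) C.O (2 ^ (C.y - 1)) L.length (C.factorOf a b TN TD UU L) 0
        (C.rowsOf a b TN TD UU L) (C.factorOf a b TN TD UU L)) := rfl
  rw [e, Bool.and_eq_true] at h
  obtain ⟨hb, hdd⟩ := h
  refine ⟨hb, ?_⟩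
  have hb' := hb
  simp only [checkBase, Bool.and_eq_true, decide_eq_true_eq, beq_iff_eq] at hb'
  obtain ⟨⟨⟨⟨⟨⟨⟨⟨_, _⟩, _⟩, _⟩, _⟩, _⟩, hlen⟩, _⟩, _⟩ := hb'
  have hlenRA : (C.rowsOf a b TN TD UU L).length = (C.factorOf a b TN TD UU L).length := by
    rw [rowsOf, length_rowsAFast, hlen]
  -- walk `ddAllN` (soundness direction, re-proved here for the `rowPass` presentation)
  have walk : ∀ (i₀ : ℕ) (RAs : List ℕ) (qs : List Row), RAs.length = qs.length →
      ddAllN C.y C.x (C.x * (L.length - 1)) C.O (2 ^ (C.y - 1)) L.length (C.factorOf a b TN TD UU L) i₀ RAs qs = true →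
      ∀ k < qs.length, rowOK C.y C.x (C.x * (L.length - 1)) C.O (2 ^ (C.y - 1)) L.length (RAs.getD k 0)
        (qs.getD k ⟨0, 0, 0⟩) (i₀ + k) (C.factorOf a b TN TD UU L) = true := by
    intro i₀ RAs qs
    induction qs generalizing i₀ RAs with
    | nil => intro _ _ k hk; simp at hk
    | cons qi qs ih =>
        intro hl h k hk
        cases RAs with
        | nil => simp at hl
        | cons RA RAs =>
            rw [ddAllN, Bool.and_eq_true] at h
            cases k with
            | zero => simpa using h.1
            | succ k =>
                have := ih (i₀ + 1) RAs (by simpa using hl) h.2 k (by simpa using hk)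
                simpa [add_assoc, add_comm 1 k] using this
  intro i hi
  rw [rowPass_eq]
  have hi' : i < (C.factorOf a b TN TD UU L).length := by rw [hlen]; exact hi
  exact walk 0 _ _ hlenRA hdd i hi'

/-- **SOUNDNESS in pieces**: `Passes ⇒ (c/Q)·‖v‖² ≤ re⟨v, H v⟩` on the spin sector. [cite: KullEtAl2024, §5.3] -/
theorem sound₂ {a b p q : ℕ} {TN TD UU : ℤ} {Q : ℕ} {L : List ℕ} (h : C.Passes a b p q TN TD UU Q L)
    (v : Fock (Orb (Fin a ×ₗ Fin b))) (hv : ∀ s, ¬((upPart s).card = p ∧ (downPart s).card = q) → v s = 0) :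
    ((C.floor Q : ℚ) : ℝ) * (star v ⬝ᵥ v).re ≤
      (star v ⬝ᵥ (hubbardOpenBoxTT' a b ((TN : ℝ) / Q) ((TD : ℝ) / Q) ((UU : ℝ) / Q) *ᵥ v)).re :=
  C.sound (C.check_of_passes h) v hv

end KCert

/-- **Certificate form in pieces with the spin-exchange symmetry.** As `groundEnergy_ge_of_kCerts₂`, with the
hypotheses `Passes` (base + row blocks) instead of the one Boolean. [cite: KullEtAl2024, §5.3] [cite: LiebPRL1989, proof of Theorem 1] -/
theorem groundEnergy_ge_of_kCerts₃ (a b : ℕ) (TN TD UU : ℤ) (Q : ℕ) {k : ℕ} (hk : k ≤ 2 * (a * b))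
    (σ : ℚ) (Ls : ℕ → List ℕ) (certs : ℕ → KCert)
    (hpass : ∀ p ≤ k, p ≤ k - p → (certs p).Passes a b p (k - p) TN TD UU Q (Ls p))
    (hσ : ∀ p ≤ k, p ≤ k - p → σ ≤ (certs p).floor Q) :
    (σ : ℝ) ≤ groundEnergy (hubbardOpenBoxTT' a b ((TN : ℝ) / Q) ((TD : ℝ) / Q) ((UU : ℝ) / Q)) k :=
  groundEnergy_ge_of_kCerts₂ a b TN TD UU Q hk σ Ls certs (fun p hp hpp => (certs p).check_of_passes (hpass p hp hpp)) hσ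

end OccupationCode

end Literature.MathematicalPhysics.QuantumLattice
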